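import Mathlib
import Summits.Ventures.PercRepro2.Defs
import Summits.Ventures.PercRepro2.Graph
import Summits.Ventures.PercRepro2.Events
import Summits.Ventures.PercRepro2.Harris
import Summits.Ventures.PercRepro2.BHKAvoid

/-!
# The root-and-`o`-far lemma (L6): row 2′ROOTLEAF-o (blind cell PercRepro2, mine-2 g13)

Four vertices `a₂ x a₃ b` of a finite weighted graph; `S = C(a₂)`, `T = C(x)`. With the events
`R_X = {a₂ ↮ X}` (`avoidAll`), `B = {a₂ ↔ b}`, `X₃ = {x ↔ a₃}`, `N = X₃ᶜ` and the seven
probabilities of MINE2-CUTVERTEX.md §13.15 (a)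

  `r = P(R_x)`, `e₀ = P(B)`, `e = P(R_x ∩ B)`, `λ = P(R_x ∩ X₃)`, `μ = P(R_x ∩ X₃ ∩ B)`,
  `c = P(R_{x,a₃} ∩ N)`, `a₀ = P(R_{a₃})`,

the lemma (L6) of §13.13 reads, cleared of the denominator `r²`,

  `0 ≤ c (r e₀ − e) − a₀ (e λ − r μ)`   (`H1 = r e₀ − e`, `H3 = e λ − r μ`).

It closes the weighted five-point functional (HCOV) on the two-far-mark classes «a root and `o`
behind a cut vertex» (§13.13: `γ_o(1) = 2r²(P1 + P2)`, `P2 ≥ 0`, `P1 = (L6)`). PROOF (§13.18):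
with `t = r − λ = P(R_x ∩ N)` (x apart from both `a₂` and `a₃`) the polynomial identity

  `t · [c (r e₀ − e) − a₀ (e λ − r μ)] = r c · [e₀ t − (e − μ)] + [c − a₀ t] · (e λ − r μ)`

holds, and the three brackets are nonnegative by
* `e₀ t − (e − μ) ≥ 0`: Harris for the decreasing event `R_x ∩ N` and the increasing event `B`
  (`e − μ = P(R_x ∩ N ∩ B)`);
* `c − a₀ t ≥ 0`: Harris for the decreasing events `R_{a₃}` and `R_x ∩ N`
  (`R_{a₃} ∩ R_x ∩ N = R_{x,a₃} ∩ N`) — the ω-level block `Cov(1[a₂ ↔ a₃], 1[x ↔ a₂ ∨ x ↔ a₃]) ≥ 0`;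
* `e λ − r μ ≥ 0`: BHK06 Thm 1.4 with set avoidance (`bhk_cross_cluster_avoid`, source `a₂`,
  other cluster `x`, avoided set `{x}`, up-sets `{W ∋ b}`, `{W ∋ a₃}`).
If `t = 0` then `c = 0`, `μ = e`, `λ = r` and the target is `0`.
-/

namespace Summit.Ventures.PercRepro2
namespace RootLeafO

variable {V : Type*} {E : Type*} [Fintype E] [DecidableEq E] [Fintype V] [DecidableEq V]
  {R : Type*} [CommRing R] [LinearOrder R] [IsStrictOrderedRing R]

omit [Fintype E] [DecidableEq E] [Fintype V] [DecidableEq V] in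
/-- `{a₂ ↮ X}` is a decreasing event. -/
lemma isLowerSet_avoidAll (ends : E → Sym2 V) (s : V) (X : Finset V) :
    IsLowerSet (avoidAll ends s X) := by
  intro ω ω' h hω t ht hc
  exact hω t ht (cluster_mono h s hc)

omit [Fintype E] [DecidableEq E] [Fintype V] in
/-- Avoiding `{x, a₃}` is avoiding `x` and avoiding `a₃`. -/
lemma avoidAll_pair (ends : E → Sym2 V) (s x a₃ : V) :
    avoidAll ends s {x} ∩ avoidAll ends s {a₃} = avoidAll ends s {x, a₃} := by
  ext ω
  simp only [Set.mem_inter_iff, avoidAll, Set.mem_setOf_eq, Finset.mem_singleton,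
    Finset.mem_insert, forall_eq, forall_eq_or_imp]

omit [Fintype E] [DecidableEq E] [Fintype V] [DecidableEq V] in
/-- `{C(s) ∋ v}` is the connection event `{s ↔ v}`. -/
lemma clusterInEvent_mem_eq (ends : E → Sym2 V) (s v : V) :
    clusterInEvent ends s {W | v ∈ W} = connEvent ends s v := by
  ext ω
  simp only [mem_clusterInEvent, Set.mem_setOf_eq, cluster, mem_connEvent]

omit [Fintype E] [DecidableEq E] [Fintype V] [DecidableEq V] in
/-- The family of vertex sets containing `v` is an up-set. -/
lemma isUpperSet_mem (v : V) : IsUpperSet {W : Set V | v ∈ W} := fun _ _ h hW => h hW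

/-- **Lemma (L6), row 2′ROOTLEAF-o** (cleared form `r² · (L6) ≥ 0`). -/
theorem rootleaf_o_nonneg (p : E → R) (hp : IsProbVec p) (ends : E → Sym2 V) (a₂ x a₃ b : V) :
    let Rx := avoidAll ends a₂ {x}
    let R3 := avoidAll ends a₂ {a₃}
    let Rx3 := avoidAll ends a₂ {x, a₃}
    let B := connEvent ends a₂ b
    let X3 := connEvent ends x a₃
    let N := (connEvent ends x a₃)ᶜ
    0 ≤ prob p (Rx3 ∩ N) * (prob p Rx * prob p B - prob p (Rx ∩ B)) -
        prob p R3 * (prob p (Rx ∩ B) * prob p (Rx ∩ X3) - prob p Rx * prob p (Rx ∩ X3 ∩ B)) := by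
  intro Rx R3 Rx3 B X3 N
  -- names
  set r := prob p Rx with hr
  set e₀ := prob p B with he₀
  set e := prob p (Rx ∩ B) with he
  set lam := prob p (Rx ∩ X3) with hlam
  set μ := prob p (Rx ∩ X3 ∩ B) with hμ
  set c := prob p (Rx3 ∩ N) with hc
  set a₀ := prob p R3 with ha₀
  set t := prob p (Rx ∩ N) with ht
  set f := prob p (Rx ∩ N ∩ B) with hf
  -- monotonicity of the events
  have hRxN : IsLowerSet (Rx ∩ N) :=
    (isLowerSet_avoidAll ends a₂ {x}).inter (isUpperSet_connEvent ends x a₃).compl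
  -- `t = r − λ`
  have e1 : t = r - lam := by
    have := prob_inter_add_prob_inter_compl p Rx X3
    simp only [N, X3] at ht this ⊢; linarith
  -- `f = e − μ`
  have e2 : f = e - μ := by
    have h1 := prob_inter_add_prob_inter_compl p (Rx ∩ B) X3
    have h2 : Rx ∩ B ∩ X3 = Rx ∩ X3 ∩ B := by
      ext ω; simp only [Set.mem_inter_iff]; tauto
    have h3 : Rx ∩ B ∩ X3ᶜ = Rx ∩ N ∩ B := by
      simp only [N, X3]; ext ω; simp only [Set.mem_inter_iff, Set.mem_compl_iff]; tauto
    rw [h2, h3] at h1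
    simp only [N, X3] at hf h1 ⊢; linarith
  -- `R_{a₃} ∩ (R_x ∩ N) = R_{x,a₃} ∩ N`
  have e3 : R3 ∩ (Rx ∩ N) = Rx3 ∩ N := by
    have := avoidAll_pair ends a₂ x a₃
    simp only [Rx3, Rx, R3] at this ⊢
    rw [← this]; ext ω; simp only [Set.mem_inter_iff]; tauto
  -- (i) Harris: `f ≤ t e₀`
  have h1 : f ≤ t * e₀ :=
    prob_inter_le_prob_mul_prob_of_isLowerSet hp hRxN (isUpperSet_connEvent ends a₂ b)
  -- (ii) Harris: `a₀ t ≤ c`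
  have h2 : a₀ * t ≤ c := by
    have := prob_mul_prob_le_prob_inter_of_isLowerSet hp (isLowerSet_avoidAll ends a₂ {a₃}) hRxN
    rw [e3] at this
    exact this
  -- (iii) BHK 1.4 with avoidance of `{x}`: `r μ ≤ e λ`
  have h3 : r * μ ≤ e * lam := by
    have key := bhk_cross_cluster_avoid p hp ends a₂ x (X := {x}) (by simp)
      (isUpperSet_mem b) (isUpperSet_mem a₃)
    rw [clusterInEvent_mem_eq, clusterInEvent_mem_eq] at key
    have eμ : connEvent ends a₂ b ∩ connEvent ends x a₃ ∩ Rx = Rx ∩ X3 ∩ B := by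
      ext ω; simp only [Set.mem_inter_iff, X3, B]; tauto
    have ee : connEvent ends a₂ b ∩ Rx = Rx ∩ B := Set.inter_comm _ _
    have elam : connEvent ends x a₃ ∩ Rx = Rx ∩ X3 := Set.inter_comm _ _
    rw [eμ, ee, elam] at key
    linarith [key]
  -- nonnegativity of the probabilities
  have hr0 : 0 ≤ r := prob_nonneg hp _
  have hc0 : 0 ≤ c := prob_nonneg hp _
  have ht0 : 0 ≤ t := prob_nonneg hp _
  -- the identity and the conclusion
  have hid : t * (c * (r * e₀ - e) - a₀ * (e * lam - r * μ)) =
      r * c * (e₀ * t - (e - μ)) + (c - a₀ * t) * (e * lam - r * μ) := by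
    rw [e1]; ring
  have hprod : 0 ≤ t * (c * (r * e₀ - e) - a₀ * (e * lam - r * μ)) := by
    rw [hid]
    have t1 : 0 ≤ r * c * (e₀ * t - (e - μ)) := mul_nonneg (mul_nonneg hr0 hc0) (by linarith)
    have t2 : 0 ≤ (c - a₀ * t) * (e * lam - r * μ) := mul_nonneg (by linarith) (by linarith)
    linarith
  rcases ht0.lt_or_eq with htpos | htzero
  · exact (mul_nonneg_iff_of_pos_left htpos).mp hprod
  · -- `t = 0` forces `c = 0`, `f = 0` (so `μ = e`) and `λ = r`
    have hc0' : c = 0 := by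
      apply le_antisymm _ hc0
      calc c ≤ t := prob_mono hp (Set.inter_subset_inter_left _ (by
              simp only [Rx3, Rx]; rw [← avoidAll_pair]; exact Set.inter_subset_left))
        _ = 0 := htzero.symm
    have hf0 : f = 0 := by
      apply le_antisymm _ (prob_nonneg hp _)
      calc f ≤ t := prob_mono hp Set.inter_subset_left
        _ = 0 := htzero.symm
    have hμe : μ = e := by linarith
    have hlr : lam = r := by linarith
    rw [hc0', hμe, hlr]; ring_nf; exact le_refl 0

end RootLeafO
end Summit.Ventures.PercRepro2
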